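import Mathlib.Analysis.InnerProductSpace.PiL2
import Literature.MathematicalPhysics.QuantumFieldTheory.Balaban1983to89.B9Thm311Whole

/-!
# `Balaban1983to89.B9Thm311ReadingCoords` — [B9] Theorem 3.11 (p. 416) read at def-Y's letters, part 1: WEIGHTED REAL
# TRACE COORDINATES of `𝔸 = M_N(ℂ)`-valued lattice functions, and the transport of «positive definite», «symmetric»,
# «adjoint», «small» and of two-sided inverses between the genuine operators and their coordinate pictures

T. Bałaban, *Propagators for lattice gauge theories in a background field*, Commun. Math. Phys. **99** (1985) 389–434
[`Balaban1985BackgroundPropagators`, "B9"]; [3] = T. Bałaban, *Propagators and renormalization transformations for lattice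
gauge theories. I*, Commun. Math. Phys. **95** (1984) 17–40 [`Balaban1984PropagatorsI`].

statement-level skeleton of published theorems with citation tags; proofs where landed; nothing here is a claim about the
Yang–Mills mass gap

THE PRINTED LOCI (verbatim).  p. 416, Theorem 3.11: *"Under the assumptions of the Theorems 3.1–3.10 (i.e. for M sufficiently
large and α₀ sufficiently small) the operators Δ′_a, G′, (Q′G′²Q′\*)⁻¹, Δ_a, G are positive definite. … It is a symmetric and
invertible operator, so if it is not positive, then there exists A₀ ≠ 0, λ₀ > 0 such that GA₀ = −λ₀A₀."*;  p. 389: *"gauge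
field A with values in the Lie algebra 𝔤"* (the functions are `𝔤 ⊂ M_N(ℂ)`-valued);  p. 393 (the scalar products of site, block
and bond functions; Q′\* the adjoint of Q′);  [4] = *Propagators … II*, (2.69) p. 235 (the block pairing with the block weight).

WHY THIS FILE.  Row 17 of the N06 knit consumes Theorem 3.11 as `B9.Thm311Printed … PosDef` at the pin `(ops x).PosDef =
PosDefOfOps (𝔬311 x)` (`B9Thm311Whole`), where `𝔬311 : Ops311 B E F W` carries the five operators as ℝ-linear maps of abstract
real inner-product spaces `E F W`.  At def-Y's instance of record the genuine operators act ℂ-linearly on `S → M_N(ℂ)` (`S` =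
sites ∕ blocks ∕ fine bonds; def-Y `deltaPrimeAY`, `GpY`, `QpY`, `QpsY`, `XinvY`, `deltaAY`, `GAY`), and print's scalar products
are the WEIGHTED real trace pairings Σ_s w_s·Re tr(Φ(s)\*Ψ(s)) (site weight 1, block weight = block volume `W` — the weight
for which Q′\* IS the adjoint of Q′, [4] (2.69); with unweighted block coordinates the printed clause «Q′\* = (Q′)\*» would be
false at the letters).  THIS FILE supplies the dictionary between the two: for a positive weight `w` the ℝ-linear
equivalence `realify311 w hw : (S → M_n(ℂ)) ≃ₗ[ℝ] EuclideanSpace ℝ (S × (n × n) × Fin 2)` (matrix units × {re, im}, scaled by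
√w_s — ORTHONORMAL for the weighted trace pairing: `inner_realify311`), the conjugation `conj311 eX eY T = eY ∘ T ∘ eX⁻¹` of a
genuine operator into coordinates, and the transport lemmas: `B9Thm311Data.PosDef (conj311 e e T) ↔ PosDefTr w T` (genuine
trace-form positivity), symmetry ↔ `IsSymmTr`, adjointness ↔ `IsAdjTr`, the L²-smallness clause ↔ its trace form,
injectivity, and two-sided inverses from `IsUnit` (finite dimension).  Part 2 (`B9Thm311ReadingAtLetters`) pins `Ops311` to
def-Y's letters with these and derives row 17 at `opsYOfLetters ∕ opsYOfRecord`.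

* §1 `Idx311`, `cpart`, `trIP w Φ Ψ` (the weighted real trace pairing, `trIP_eq_re_trace`), `coordFun ∕ uncoordFun`, ★ `realify311`,
  ★ `inner_realify311`, `norm_sq_realify311`.
* §2 `conj311` and its algebra (`conj311_apply ∕ _comp ∕ _one ∕ _mul ∕ _sub`, `injective_conj311_iff`).
* §3 transport: `posDef_conj311_iff`, ★ `posDef_conj311_realify311_iff`, `symm_conj311_realify311_iff`, `adj_conj311_realify311_iff`,
  `small_conj311_realify311_iff`; the trace-currency predicates `PosDefTr`, `IsSymmTr`, `IsAdjTr`.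
* §4 inverses: `injective_of_posDefTr`, ★ `isUnit_of_posDefTr`, `apply_inverse_of_isUnit ∕ inverse_apply_of_isUnit`,
  `conj311_apply_conj311_inverse`.

HONEST SCOPE.  Finite-dimensional real∕complex linear algebra and bookkeeping only ([folklore] level, cited to the printed
step it serves); nothing of [B9] is asserted; NOT a node discharge, NOT summit progress; count-neutral; nothing continuum,
nothing about the mass gap.  Cell `pub-ymgap` (HUMAN RULING D-0062), Track A node N06 [B9], seat `pub-ymgap-dag-n06-j`
(harness re-seat gen 6, row 17 at the letters), 2026-08-27.
-/

namespace Literature.MathematicalPhysics.QuantumFieldTheory.Balaban1983to89.B9Thm311ReadingCoords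

open Literature.MathematicalPhysics.QuantumFieldTheory.Balaban1983to89
open Finset
open scoped Matrix

noncomputable section

/-! ## §1 Weighted real trace coordinates of `S → M_n(ℂ)` -/

section Coords

variable {S n : Type} [Fintype S] [Fintype n]

/-- the index set of the real coordinates of `S → M_n(ℂ)`: a lattice point, a matrix unit, and re ∕ im.
[cite: Balaban1985BackgroundPropagators, p.389 («A with values in the Lie algebra 𝔤»), dictionary] -/
abbrev Idx311 (S n : Type) : Type := S × (n × n) × Fin 2

/-- the `c`-th real coordinate of a complex number: `re` for `c = 0`, `im` for `c = 1`. [cite: Balaban1985BackgroundPropagators, p.389, dictionary] -/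
def cpart (c : Fin 2) (z : ℂ) : ℝ := if c = 0 then z.re else z.im

/-- coordinate `0` is the real part. [cite: Balaban1985BackgroundPropagators, p.389, bookkeeping] -/
@[simp] theorem cpart_zero (z : ℂ) : cpart 0 z = z.re := by simp [cpart]

/-- coordinate `1` is the imaginary part. [cite: Balaban1985BackgroundPropagators, p.389, bookkeeping] -/
@[simp] theorem cpart_one (z : ℂ) : cpart 1 z = z.im := by simp [cpart]

/-- the coordinates are additive. [cite: Balaban1985BackgroundPropagators, p.389, bookkeeping] -/
theorem cpart_add (c : Fin 2) (z w : ℂ) : cpart c (z + w) = cpart c z + cpart c w := by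
  fin_cases c <;> simp

/-- the coordinates are ℝ-homogeneous. [cite: Balaban1985BackgroundPropagators, p.389, bookkeeping] -/
theorem cpart_smul (c : Fin 2) (r : ℝ) (z : ℂ) : cpart c (r • z) = r * cpart c z := by
  fin_cases c <;> simp

/-- `Re(z̄·w) = Re z·Re w + Im z·Im w` — the real trace pairing of two entries in coordinates. [cite: Balaban1985BackgroundPropagators, p.393 (scalar products), bookkeeping] -/
theorem re_star_mul (z w : ℂ) : (star z * w).re = z.re * w.re + z.im * w.im := by
  have h : star z = (starRingEnd ℂ) z := rfl
  rw [h, Complex.mul_re, Complex.conj_re, Complex.conj_im]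
  ring

/-- the two coordinates pair to the real trace pairing of the entries. [cite: Balaban1985BackgroundPropagators, p.393 (scalar products), bookkeeping] -/
theorem sum_cpart_mul_cpart (z w : ℂ) : ∑ c : Fin 2, cpart c z * cpart c w = (star z * w).re := by
  rw [Fin.sum_univ_two, cpart_zero, cpart_zero, cpart_one, cpart_one, re_star_mul]

/-- **THE WEIGHTED REAL TRACE PAIRING** `⟨Φ, Ψ⟩_w = Σ_s w(s)·Re tr(Φ(s)\*Ψ(s))`, written in matrix entries
(`Σ_s w(s)·Σ_{a,b} Re(Φ(s)_{ab}̄ ·Ψ(s)_{ab})`): print's scalar products of `𝔤`-valued site ∕ block ∕ bond functions (site and bond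
weight a constant, block weight the block volume). [cite: Balaban1985BackgroundPropagators, p.393 (scalar products); Balaban1984PropagatorsII, (2.69) p.235] -/
def trIP (w : S → ℝ) (Φ Ψ : S → Matrix n n ℂ) : ℝ :=
  ∑ s, w s * ∑ a, ∑ b, (star (Φ s a b) * Ψ s a b).re

/-- the pairing IS `Σ_s w(s)·Re tr(Φ(s)ᴴ Ψ(s))`. [cite: Balaban1985BackgroundPropagators, p.393 (scalar products), bookkeeping] -/
theorem trIP_eq_re_trace (w : S → ℝ) (Φ Ψ : S → Matrix n n ℂ) :
    trIP w Φ Ψ = ∑ s, w s * (Matrix.trace ((Φ s)ᴴ * Ψ s)).re := by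
  unfold trIP
  refine Finset.sum_congr rfl fun s _ => ?_
  congr 1
  rw [Matrix.trace, Complex.re_sum, Finset.sum_comm]
  refine Finset.sum_congr rfl fun b _ => ?_
  rw [Matrix.diag_apply, Matrix.mul_apply, Complex.re_sum]
  refine Finset.sum_congr rfl fun a _ => ?_
  rw [Matrix.conjTranspose_apply]

/-- the pairing vanishes on `0` on the right. [cite: Balaban1985BackgroundPropagators, p.393, bookkeeping] -/
@[simp] theorem trIP_zero_right (w : S → ℝ) (Φ : S → Matrix n n ℂ) : trIP w Φ 0 = 0 := by
  simp [trIP]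

/-- the real coordinates of `Φ : S → M_n(ℂ)` for the weight `w`: `(s, (a,b), c) ↦ √w(s) · (Re ∕ Im) Φ(s)_{ab}`.
[cite: Balaban1985BackgroundPropagators, p.393 (scalar products), dictionary] -/
def coordFun (w : S → ℝ) (Φ : S → Matrix n n ℂ) : Idx311 S n → ℝ :=
  fun p => Real.sqrt (w p.1) * cpart p.2.2 (Φ p.1 p.2.1.1 p.2.1.2)

/-- the inverse chart: a real coordinate vector read back as `S → M_n(ℂ)`. [cite: Balaban1985BackgroundPropagators, p.393, dictionary] -/
def uncoordFun (w : S → ℝ) (v : Idx311 S n → ℝ) : S → Matrix n n ℂ :=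
  fun s => Matrix.of fun a b => (⟨(Real.sqrt (w s))⁻¹ * v (s, (a, b), 0), (Real.sqrt (w s))⁻¹ * v (s, (a, b), 1)⟩ : ℂ)

omit [Fintype S] [Fintype n] in
/-- the coordinate map is additive. [cite: Balaban1985BackgroundPropagators, p.393, bookkeeping] -/
theorem coordFun_add (w : S → ℝ) (Φ Ψ : S → Matrix n n ℂ) : coordFun w (Φ + Ψ) = coordFun w Φ + coordFun w Ψ := by
  funext p; simp only [coordFun, Pi.add_apply, Matrix.add_apply, cpart_add, mul_add]

omit [Fintype S] [Fintype n] in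
/-- the coordinate map is ℝ-homogeneous. [cite: Balaban1985BackgroundPropagators, p.393, bookkeeping] -/
theorem coordFun_smul (w : S → ℝ) (r : ℝ) (Φ : S → Matrix n n ℂ) : coordFun w (r • Φ) = r • coordFun w Φ := by
  funext p; simp only [coordFun, Pi.smul_apply, Matrix.smul_apply, cpart_smul, smul_eq_mul]; ring

/-- ★ **THE WEIGHTED REAL TRACE COORDINATES**: for a positive weight `w`, the ℝ-linear equivalence of `S → M_n(ℂ)` with the
Euclidean space on `S × (n × n) × Fin 2` (matrix units × {re, im}, scaled by `√w(s)`) — orthonormal coordinates for print's weighted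
scalar product (`inner_realify311`). [cite: Balaban1985BackgroundPropagators, p.393 (scalar products); Balaban1984PropagatorsII, (2.69) p.235] -/
def realify311 (w : S → ℝ) (hw : ∀ s, 0 < w s) : (S → Matrix n n ℂ) ≃ₗ[ℝ] EuclideanSpace ℝ (Idx311 S n) where
  toFun Φ := WithLp.toLp 2 (coordFun w Φ)
  invFun v := uncoordFun w (WithLp.ofLp v)
  map_add' Φ Ψ := by rw [← WithLp.toLp_add, coordFun_add]
  map_smul' r Φ := by rw [RingHom.id_apply, ← WithLp.toLp_smul, coordFun_smul]
  left_inv Φ := by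
    have hs : ∀ s, Real.sqrt (w s) ≠ 0 := fun s => (Real.sqrt_pos.mpr (hw s)).ne'
    funext s; ext a b; apply Complex.ext
    · simp [uncoordFun, coordFun, cpart, inv_mul_cancel_left₀ (hs s)]
    · simp [uncoordFun, coordFun, cpart, inv_mul_cancel_left₀ (hs s)]
  right_inv v := by
    have hs : ∀ s, Real.sqrt (w s) ≠ 0 := fun s => (Real.sqrt_pos.mpr (hw s)).ne'
    apply WithLp.ofLp_injective 2
    funext p; obtain ⟨s, ⟨a, b⟩, c⟩ := p; fin_cases c
    · simp [coordFun, uncoordFun, cpart, mul_inv_cancel_left₀ (hs s)]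
    · simp [coordFun, uncoordFun, cpart, mul_inv_cancel_left₀ (hs s)]

variable {w : S → ℝ} {hw : ∀ s, 0 < w s}

omit [Fintype S] [Fintype n] in
/-- the chart, unfolded. [cite: Balaban1985BackgroundPropagators, p.393, bookkeeping] -/
theorem realify311_apply (Φ : S → Matrix n n ℂ) : realify311 w hw Φ = WithLp.toLp 2 (coordFun w Φ) := rfl

/-- ★ **THE COORDINATES ARE ORTHONORMAL FOR THE WEIGHTED TRACE PAIRING**: `⟪e Φ, e Ψ⟫ = Σ_s w(s)·Re tr(Φ(s)\*Ψ(s))`.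
[cite: Balaban1985BackgroundPropagators, p.393 (scalar products); Balaban1984PropagatorsII, (2.69) p.235] -/
theorem inner_realify311 (Φ Ψ : S → Matrix n n ℂ) :
    inner ℝ (realify311 w hw Φ) (realify311 w hw Ψ) = trIP w Φ Ψ := by
  rw [realify311_apply, realify311_apply, EuclideanSpace.inner_toLp_toLp, dotProduct, trIP, Fintype.sum_prod_type]
  refine Finset.sum_congr rfl fun s _ => ?_
  rw [Fintype.sum_prod_type, Fintype.sum_prod_type, Finset.mul_sum]
  refine Finset.sum_congr rfl fun a _ => ?_
  rw [Finset.mul_sum]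
  refine Finset.sum_congr rfl fun b _ => ?_
  have hs : Real.sqrt (w s) * Real.sqrt (w s) = w s := Real.mul_self_sqrt (hw s).le
  rw [← sum_cpart_mul_cpart, Finset.mul_sum]
  refine Finset.sum_congr rfl fun c _ => ?_
  simp only [coordFun, Pi.star_apply, star_trivial]
  linear_combination (cpart c (Φ s a b) * cpart c (Ψ s a b)) * hs

/-- the coordinate norm squared is the weighted trace norm `Σ_s w(s)·Re tr(Φ(s)\*Φ(s))`. [cite: Balaban1985BackgroundPropagators, p.393 (scalar products), bookkeeping] -/
theorem norm_sq_realify311 (Φ : S → Matrix n n ℂ) : ‖realify311 w hw Φ‖ ^ 2 = trIP w Φ Φ := by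
  rw [← real_inner_self_eq_norm_sq, inner_realify311]

end Coords

/-! ## §2 Conjugation of a genuine operator into coordinates -/

section Conj

variable {X Y Z EX EY EZ : Type*}
variable [AddCommGroup X] [Module ℝ X] [Module ℂ X] [AddCommGroup Y] [Module ℝ Y] [Module ℂ Y]
  [AddCommGroup Z] [Module ℝ Z] [Module ℂ Z]
  [LinearMap.CompatibleSMul X Y ℝ ℂ] [LinearMap.CompatibleSMul Y Z ℝ ℂ] [LinearMap.CompatibleSMul X Z ℝ ℂ]
  [AddCommGroup EX] [Module ℝ EX] [AddCommGroup EY] [Module ℝ EY] [AddCommGroup EZ] [Module ℝ EZ]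

/-- **CONJUGATION INTO COORDINATES**: the genuine ℂ-linear operator `T : X → Y` read through the real charts `eX`, `eY` as the
ℝ-linear map `eY ∘ T ∘ eX⁻¹` of the coordinate spaces — the shape in which def-Y's letters inhabit `B9Thm311Whole.Ops311`.
[cite: Balaban1985BackgroundPropagators, Thm 3.11 p.416 (the operators), dictionary] -/
def conj311 (eX : X ≃ₗ[ℝ] EX) (eY : Y ≃ₗ[ℝ] EY) (T : X →ₗ[ℂ] Y) : EX →ₗ[ℝ] EY :=
  eY.toLinearMap ∘ₗ T.restrictScalars ℝ ∘ₗ eX.symm.toLinearMap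

/-- conjugation, evaluated. [cite: Balaban1985BackgroundPropagators, Thm 3.11 p.416, bookkeeping] -/
@[simp] theorem conj311_apply (eX : X ≃ₗ[ℝ] EX) (eY : Y ≃ₗ[ℝ] EY) (T : X →ₗ[ℂ] Y) (v : EX) :
    conj311 eX eY T v = eY (T (eX.symm v)) := rfl

/-- conjugation is multiplicative along compositions. [cite: Balaban1985BackgroundPropagators, Thm 3.11 p.416, bookkeeping] -/
theorem conj311_comp (eX : X ≃ₗ[ℝ] EX) (eY : Y ≃ₗ[ℝ] EY) (eZ : Z ≃ₗ[ℝ] EZ) (T₂ : Y →ₗ[ℂ] Z) (T₁ : X →ₗ[ℂ] Y) :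
    conj311 eX eZ (T₂ ∘ₗ T₁) = conj311 eY eZ T₂ ∘ₗ conj311 eX eY T₁ := by
  ext v; simp

/-- conjugation is subtractive. [cite: Balaban1985BackgroundPropagators, (3.105) p.414 (I − R), bookkeeping] -/
theorem conj311_sub (eX : X ≃ₗ[ℝ] EX) (eY : Y ≃ₗ[ℝ] EY) (A B : X →ₗ[ℂ] Y) :
    conj311 eX eY (A - B) = conj311 eX eY A - conj311 eX eY B := by
  ext v; simp

/-- conjugation by equivalences preserves and reflects injectivity. [cite: Balaban1984PropagatorsI, p.25 («Q′*_kω = 0, hence ω = 0»), bookkeeping] -/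
theorem injective_conj311_iff (eX : X ≃ₗ[ℝ] EX) (eY : Y ≃ₗ[ℝ] EY) (T : X →ₗ[ℂ] Y) :
    Function.Injective (conj311 eX eY T) ↔ Function.Injective T := by
  constructor
  · intro h x x' hxx'
    exact eX.injective (h (by simp [hxx'] : conj311 eX eY T (eX x) = conj311 eX eY T (eX x')))
  · intro h v v' hvv'
    exact eX.symm.injective (h (eY.injective (by simpa using hvv')))

end Conj

section ConjEnd

variable {X EX : Type*} [AddCommGroup X] [Module ℝ X] [Module ℂ X] [LinearMap.CompatibleSMul X X ℝ ℂ]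
  [AddCommGroup EX] [Module ℝ EX]

/-- conjugation of `1 : Module.End ℂ X` is `1`. [cite: Balaban1985BackgroundPropagators, Thm 3.11 p.416, bookkeeping] -/
@[simp] theorem conj311_one (eX : X ≃ₗ[ℝ] EX) : conj311 eX eX (1 : Module.End ℂ X) = 1 := by
  ext v; simp

/-- conjugation is multiplicative on endomorphisms. [cite: Balaban1985BackgroundPropagators, Thm 3.11 p.416, bookkeeping] -/
theorem conj311_mul (eX : X ≃ₗ[ℝ] EX) (A B : Module.End ℂ X) :
    conj311 eX eX (A * B) = conj311 eX eX A ∘ₗ conj311 eX eX B := by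
  ext v; simp

/-- `I − R` conjugates to `I − (R conjugated)`. [cite: Balaban1985BackgroundPropagators, (3.105)–(3.106) p.414, bookkeeping] -/
theorem conj311_one_sub (eX : X ≃ₗ[ℝ] EX) (R : Module.End ℂ X) :
    conj311 eX eX (1 - R) = 1 - conj311 eX eX R := by
  rw [conj311_sub, conj311_one]

end ConjEnd

/-! ## §3 Transport of «positive definite», «symmetric», «adjoint», «small» -/

section Transport

variable {X V : Type*}
variable [AddCommGroup X] [Module ℝ X] [Module ℂ X] [LinearMap.CompatibleSMul X X ℝ ℂ]
  [NormedAddCommGroup V] [InnerProductSpace ℝ V]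

/-- «positive definite» of the coordinate picture ↔ positivity of the genuine quadratic form read through the chart.
[cite: Balaban1985BackgroundPropagators, Thm 3.11 p.416] -/
theorem posDef_conj311_iff (e : X ≃ₗ[ℝ] V) (T : X →ₗ[ℂ] X) :
    B9Thm311Data.PosDef (conj311 e e T) ↔ ∀ x : X, x ≠ 0 → 0 < inner ℝ (e x) (e (T x)) := by
  constructor
  · intro h x hx
    simpa using h (e x) (fun h0 => hx (e.map_eq_zero_iff.mp h0))
  · intro h v hv
    have := h (e.symm v) (fun h0 => hv (e.symm.map_eq_zero_iff.mp h0))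
    rwa [LinearEquiv.apply_symm_apply] at this

/-- «symmetric» of the coordinate picture ↔ symmetry of the genuine operator read through the chart.
[cite: Balaban1985BackgroundPropagators, Thm 3.11 p.416 («It is a symmetric … operator»)] -/
theorem symm_conj311_iff (e : X ≃ₗ[ℝ] V) (T : X →ₗ[ℂ] X) :
    (∀ u v : V, inner ℝ (conj311 e e T u) v = inner ℝ u (conj311 e e T v)) ↔
      ∀ x y : X, inner ℝ (e (T x)) (e y) = inner ℝ (e x) (e (T y)) := by
  exact ⟨fun h x y => by simpa using h (e x) (e y), fun h u v => by simpa using h (e.symm u) (e.symm v)⟩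

/-- the L²-smallness clause of the coordinate picture ↔ the genuine one read through the chart.
[cite: Balaban1985BackgroundPropagators, Thm 3.11 proof p.416 («(1 − O(M⁻¹))⟨A, A⟩»)] -/
theorem small_conj311_iff (e : X ≃ₗ[ℝ] V) (R : X →ₗ[ℂ] X) (θ : ℝ) :
    (∀ A : V, inner ℝ A (conj311 e e R A) ≤ θ * ‖A‖ ^ 2) ↔
      ∀ x : X, inner ℝ (e x) (e (R x)) ≤ θ * ‖e x‖ ^ 2 := by
  exact ⟨fun h x => by simpa using h (e x), fun h A => by simpa using h (e.symm A)⟩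

end Transport

section TransportAdj

variable {X Y V V' : Type*}
variable [AddCommGroup X] [Module ℝ X] [Module ℂ X] [AddCommGroup Y] [Module ℝ Y] [Module ℂ Y]
  [LinearMap.CompatibleSMul X Y ℝ ℂ] [LinearMap.CompatibleSMul Y X ℝ ℂ]
  [NormedAddCommGroup V] [InnerProductSpace ℝ V] [NormedAddCommGroup V'] [InnerProductSpace ℝ V']

/-- «Q′\* is the adjoint of Q′» of the coordinate pictures ↔ the genuine adjointness read through the charts.
[cite: Balaban1985BackgroundPropagators, p.393 (scalar products; Q′*)] -/
theorem adj_conj311_iff (eX : X ≃ₗ[ℝ] V) (eY : Y ≃ₗ[ℝ] V') (Q : X →ₗ[ℂ] Y) (Qs : Y →ₗ[ℂ] X) :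
    (∀ (u : V) (φ : V'), inner ℝ (conj311 eX eY Q u) φ = inner ℝ u (conj311 eY eX Qs φ)) ↔
      ∀ (x : X) (y : Y), inner ℝ (eY (Q x)) (eY y) = inner ℝ (eX x) (eX (Qs y)) := by
  exact ⟨fun h x y => by simpa using h (eX x) (eY y), fun h u φ => by simpa using h (eX.symm u) (eY.symm φ)⟩

end TransportAdj

/-! ### The trace-currency predicates and the transport through `realify311` -/

section TraceCurrency

variable {S S' n : Type} [Fintype S] [Fintype S'] [Fintype n]

/-- **«positive definite» IN GENUINE CURRENCY**: `∀ Φ ≠ 0, 0 < Σ_s w(s)·Re tr(Φ(s)\*(TΦ)(s))` — Theorem 3.11's conclusion for an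
operator on `𝔤`-valued lattice functions, with print's weighted scalar product. [cite: Balaban1985BackgroundPropagators, Thm 3.11 p.416] -/
def PosDefTr (w : S → ℝ) (T : (S → Matrix n n ℂ) →ₗ[ℂ] (S → Matrix n n ℂ)) : Prop :=
  ∀ Φ : S → Matrix n n ℂ, Φ ≠ 0 → 0 < trIP w Φ (T Φ)

/-- **«symmetric» IN GENUINE CURRENCY** (w.r.t. the weighted trace pairing). [cite: Balaban1985BackgroundPropagators, Thm 3.11 p.416 («It is a symmetric … operator»)] -/
def IsSymmTr (w : S → ℝ) (T : (S → Matrix n n ℂ) →ₗ[ℂ] (S → Matrix n n ℂ)) : Prop :=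
  ∀ Φ Ψ : S → Matrix n n ℂ, trIP w (T Φ) Ψ = trIP w Φ (T Ψ)

/-- **«Qs is the adjoint of Q» IN GENUINE CURRENCY** (weights `wX` on the source, `wY` on the target).
[cite: Balaban1985BackgroundPropagators, p.393 (Q′* the adjoint of Q′); Balaban1984PropagatorsII, (2.69) p.235] -/
def IsAdjTr (wX : S → ℝ) (wY : S' → ℝ) (Q : (S → Matrix n n ℂ) →ₗ[ℂ] (S' → Matrix n n ℂ))
    (Qs : (S' → Matrix n n ℂ) →ₗ[ℂ] (S → Matrix n n ℂ)) : Prop :=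
  ∀ (Φ : S → Matrix n n ℂ) (Ψ : S' → Matrix n n ℂ), trIP wY (Q Φ) Ψ = trIP wX Φ (Qs Ψ)

variable {w : S → ℝ} {hw : ∀ s, 0 < w s} {w' : S' → ℝ} {hw' : ∀ s, 0 < w' s}

/-- ★ «positive definite» of the coordinate picture ↔ `PosDefTr` of the genuine operator. [cite: Balaban1985BackgroundPropagators, Thm 3.11 p.416] -/
theorem posDef_conj311_realify311_iff (T : (S → Matrix n n ℂ) →ₗ[ℂ] (S → Matrix n n ℂ)) :
    B9Thm311Data.PosDef (conj311 (realify311 w hw) (realify311 w hw) T) ↔ PosDefTr w T := by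
  rw [posDef_conj311_iff]
  simp only [inner_realify311]
  rfl

/-- «symmetric» of the coordinate picture ↔ `IsSymmTr` of the genuine operator. [cite: Balaban1985BackgroundPropagators, Thm 3.11 p.416] -/
theorem symm_conj311_realify311_iff (T : (S → Matrix n n ℂ) →ₗ[ℂ] (S → Matrix n n ℂ)) :
    (∀ u v, inner ℝ (conj311 (realify311 w hw) (realify311 w hw) T u) v =
        inner ℝ u (conj311 (realify311 w hw) (realify311 w hw) T v)) ↔ IsSymmTr w T := by
  rw [symm_conj311_iff]
  simp only [inner_realify311]
  rfl

/-- «adjoint» of the coordinate pictures ↔ `IsAdjTr` of the genuine operators. [cite: Balaban1985BackgroundPropagators, p.393 (Q′*)] -/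
theorem adj_conj311_realify311_iff (Q : (S → Matrix n n ℂ) →ₗ[ℂ] (S' → Matrix n n ℂ))
    (Qs : (S' → Matrix n n ℂ) →ₗ[ℂ] (S → Matrix n n ℂ)) :
    (∀ u φ, inner ℝ (conj311 (realify311 w hw) (realify311 w' hw') Q u) φ =
        inner ℝ u (conj311 (realify311 w' hw') (realify311 w hw) Qs φ)) ↔ IsAdjTr w w' Q Qs := by
  rw [adj_conj311_iff]
  simp only [inner_realify311]
  rfl

/-- the L²-smallness clause of the coordinate picture ↔ its trace form `⟨Ψ, RΨ⟩_w ≤ θ·⟨Ψ, Ψ⟩_w`.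
[cite: Balaban1985BackgroundPropagators, Thm 3.11 proof p.416 («(1 − O(M⁻¹))⟨A, A⟩»)] -/
theorem small_conj311_realify311_iff (R : (S → Matrix n n ℂ) →ₗ[ℂ] (S → Matrix n n ℂ)) (θ : ℝ) :
    (∀ A, inner ℝ A (conj311 (realify311 w hw) (realify311 w hw) R A) ≤ θ * ‖A‖ ^ 2) ↔
      ∀ Ψ : S → Matrix n n ℂ, trIP w Ψ (R Ψ) ≤ θ * trIP w Ψ Ψ := by
  rw [small_conj311_iff]
  simp only [inner_realify311, norm_sq_realify311]

/-! ## §4 Injectivity, invertibility, two-sided inverses -/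

/-- a `PosDefTr` operator is injective. [cite: Balaban1985BackgroundPropagators, Thm 3.11 p.416 («symmetric and invertible»)] -/
theorem injective_of_posDefTr {T : (S → Matrix n n ℂ) →ₗ[ℂ] (S → Matrix n n ℂ)} (h : PosDefTr w T) :
    Function.Injective T := by
  refine (injective_iff_map_eq_zero _).mpr fun Φ hΦ => by_contra fun hne => ?_
  simpa [hΦ] using h Φ hne

/-- in finite dimension an injective endomorphism is a unit. [cite: Balaban1985BackgroundPropagators, (3.25) p.395 («G′ = (Δ′_a)⁻¹»), bookkeeping] -/
theorem isUnit_of_injective {K M : Type*} [Field K] [AddCommGroup M] [Module K M] [FiniteDimensional K M]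
    {T : M →ₗ[K] M} (h : Function.Injective T) : IsUnit T :=
  (LinearMap.isUnit_iff_ker_eq_bot T).mpr (LinearMap.ker_eq_bot.mpr h)

/-- ★ a `PosDefTr` operator (finite lattice, `M_n(ℂ)` values) is a unit of `Module.End ℂ`: its `Ring.inverse` is a genuine
two-sided inverse — print's «G′ = (Δ′_a)⁻¹» once «Δ′_a is positive». [cite: Balaban1985BackgroundPropagators, (3.25) p.395, Thm 3.11 p.416] -/
theorem isUnit_of_posDefTr {T : (S → Matrix n n ℂ) →ₗ[ℂ] (S → Matrix n n ℂ)} (h : PosDefTr w T) : IsUnit T :=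
  isUnit_of_injective (injective_of_posDefTr h)

/-- a unit followed by its `Ring.inverse` is the identity, pointwise. [cite: Balaban1985BackgroundPropagators, (3.25) p.395, bookkeeping] -/
theorem apply_inverse_of_isUnit {K M : Type*} [Semiring K] [AddCommMonoid M] [Module K M] {T : Module.End K M}
    (h : IsUnit T) (x : M) : T (Ring.inverse T x) = x := by
  exact (LinearMap.ext_iff.mp (Ring.mul_inverse_cancel T h)) x

/-- the `Ring.inverse` of a unit followed by the unit is the identity, pointwise. [cite: Balaban1985BackgroundPropagators, (3.27) p.395 («G(U) = Δ_a(U)⁻¹»), bookkeeping] -/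
theorem inverse_apply_of_isUnit {K M : Type*} [Semiring K] [AddCommMonoid M] [Module K M] {T : Module.End K M}
    (h : IsUnit T) (x : M) : Ring.inverse T (T x) = x := by
  exact (LinearMap.ext_iff.mp (Ring.inverse_mul_cancel T h)) x

variable {X EX : Type*} [AddCommGroup X] [Module ℝ X] [Module ℂ X] [LinearMap.CompatibleSMul X X ℝ ℂ]
  [AddCommGroup EX] [Module ℝ EX]

/-- in coordinates: the picture of a unit followed by the picture of its inverse is the identity.
[cite: Balaban1985BackgroundPropagators, (3.25) p.395, bookkeeping] -/
theorem conj311_apply_conj311_inverse (e : X ≃ₗ[ℝ] EX) {T : Module.End ℂ X} (h : IsUnit T) (v : EX) :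
    conj311 e e T (conj311 e e (Ring.inverse T) v) = v := by
  simp [apply_inverse_of_isUnit h]

/-- in coordinates: the picture of the inverse followed by the picture of the unit is the identity.
[cite: Balaban1985BackgroundPropagators, (3.27) p.395, bookkeeping] -/
theorem conj311_inverse_apply_conj311 (e : X ≃ₗ[ℝ] EX) {T : Module.End ℂ X} (h : IsUnit T) (v : EX) :
    conj311 e e (Ring.inverse T) (conj311 e e T v) = v := by
  simp [inverse_apply_of_isUnit h]

end TraceCurrency

end

end Literature.MathematicalPhysics.QuantumFieldTheory.Balaban1983to89.B9Thm311ReadingCoords
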